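import Mathlib.Analysis.InnerProductSpace.PiL2
import Literature.Analysis.PDE.NewtonianKernel
import Literature.Analysis.FluidPDE.KNSSRegularityGalilean
import HarnessLib

/-!
# Route HardyPointSink — `HardyBalanceLaw`: the regularised Newtonian weights on `ℝ³`

Helper file for item stmt-NavierStokesRegularity-8388 (`HardyBalanceLaw`). The Hardy balance
law is the local energy identity of a classical Navier–Stokes solution tested against the
Newtonian weight `|x - x₀|⁻¹`; the proof regularises the weight as
`φ_a(x) = (‖x - x₀‖² + a)^{-1/2} = regKernel a (x - x₀)` (`a = ε² > 0`, the tree's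
`Literature.Analysis.PDE.Newtonian.regKernel` in dimension `3`). This file collects the
pointwise calculus of these weights on `ℝ³`: closed forms, the derivative
`Dφ_a(x) = -(‖x - x₀‖² + a)^{-3/2} ⟨x - x₀, ·⟩`, the Laplacian `Δφ_a(x) = -regBump a (x - x₀) =
-3a(‖x - x₀‖² + a)^{-5/2}`, the uniform bounds `φ_a ≤ |x - x₀|⁻¹`, `‖Dφ_a‖ ≤ |x - x₀|⁻²`,
`regBump a ≤ 3a |x - x₀|⁻⁵`, and the pointwise limits as `a → 0⁺`.
-/

noncomputable section

open MeasureTheory Metric Set Filter Topology InnerProductSpace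
open Literature.Analysis.PDE
open scoped RealInnerProductSpace Laplacian

set_option linter.dupNamespace false -- nested layout Summit.<S>.<Sub>, Sub = S (D-0017)

namespace Summit.NavierStokesRegularity.NavierStokesRegularity.Theorems

/-! ### Closed forms in dimension three -/

/-- `finrank ℝ ℝ³ = 3`, as a real number. -/
theorem hardyPointSink_finrank_cast : (Module.finrank ℝ (EuclideanSpace ℝ (Fin 3)) : ℝ) = 3 := by
  rw [finrank_euclideanSpace_fin]; norm_num

/-- `3 ≤ finrank ℝ ℝ³` (the standing hypothesis of the Newtonian-kernel files). -/
theorem hardyPointSink_three_le_finrank : 3 ≤ Module.finrank ℝ (EuclideanSpace ℝ (Fin 3)) := by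
  rw [finrank_euclideanSpace_fin]

/-- In `ℝ³`, `regKernel a ξ = (‖ξ‖² + a)^{-1/2}`. -/
theorem hardyPointSink_regKernel_eq (a : ℝ) (ξ : EuclideanSpace ℝ (Fin 3)) :
    Newtonian.regKernel a ξ = (‖ξ‖ ^ 2 + a) ^ (-1 / 2 : ℝ) := by
  unfold Newtonian.regKernel Newtonian.expo
  rw [hardyPointSink_finrank_cast]
  norm_num

/-- In `ℝ³`, `regBump a ξ = 3 a (‖ξ‖² + a)^{-5/2}`. -/
theorem hardyPointSink_regBump_eq (a : ℝ) (ξ : EuclideanSpace ℝ (Fin 3)) :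
    Newtonian.regBump a ξ = 3 * a * (‖ξ‖ ^ 2 + a) ^ (-5 / 2 : ℝ) := by
  unfold Newtonian.regBump Newtonian.expo
  rw [hardyPointSink_finrank_cast]
  norm_num

/-- In `ℝ³`, `D(regKernel a)(ξ) = -(‖ξ‖² + a)^{-3/2} ⟨ξ, ·⟩` wherever `‖ξ‖² + a > 0`. -/
theorem hardyPointSink_hasFDerivAt_regKernel {a : ℝ} {ξ : (EuclideanSpace ℝ (Fin 3))} (hξ : 0 < ‖ξ‖ ^ 2 + a) :
    HasFDerivAt (Newtonian.regKernel a : (EuclideanSpace ℝ (Fin 3)) → ℝ)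
      ((-(‖ξ‖ ^ 2 + a) ^ (-3 / 2 : ℝ)) • (innerSL ℝ ξ : (EuclideanSpace ℝ (Fin 3)) →L[ℝ] ℝ)) ξ := by
  have h := Newtonian.hasFDerivAt_regKernel (E := (EuclideanSpace ℝ (Fin 3))) (a := a) hξ
  have e : (2 * (-Newtonian.expo (EuclideanSpace ℝ (Fin 3)) * (‖ξ‖ ^ 2 + a) ^ (-Newtonian.expo (EuclideanSpace ℝ (Fin 3)) - 1))) =
      -(‖ξ‖ ^ 2 + a) ^ (-3 / 2 : ℝ) := by
    unfold Newtonian.expo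
    rw [hardyPointSink_finrank_cast]
    norm_num
    ring
  rw [e] at h
  exact h

/-! ### The translated weight `x ↦ regKernel a (x - x₀)` -/

/-- The base `‖x - x₀‖² + a` is positive for `a > 0`. -/
theorem hardyPointSink_base_pos {a : ℝ} (ha : 0 < a) (x₀ x : EuclideanSpace ℝ (Fin 3)) : 0 < ‖x - x₀‖ ^ 2 + a := by
  positivity

/-- The regularised weight is smooth for `a > 0`. -/
theorem hardyPointSink_contDiff_weight {a : ℝ} (ha : 0 < a) (x₀ : EuclideanSpace ℝ (Fin 3)) {m : WithTop ℕ∞} :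
    ContDiff ℝ m (fun x : EuclideanSpace ℝ (Fin 3) => Newtonian.regKernel a (x - x₀)) :=
  (Newtonian.contDiff_regKernel ha).comp (contDiff_id.sub contDiff_const)

/-- **The derivative of the regularised weight**:
`D(regKernel a (· - x₀))(x) = -(‖x - x₀‖² + a)^{-3/2} ⟨x - x₀, ·⟩` (`a > 0`). -/
theorem hardyPointSink_hasFDerivAt_weight {a : ℝ} (ha : 0 < a) (x₀ x : EuclideanSpace ℝ (Fin 3)) :
    HasFDerivAt (fun y : EuclideanSpace ℝ (Fin 3) => Newtonian.regKernel a (y - x₀))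
      ((-(‖x - x₀‖ ^ 2 + a) ^ (-3 / 2 : ℝ)) • (innerSL ℝ (x - x₀) : (EuclideanSpace ℝ (Fin 3)) →L[ℝ] ℝ)) x := by
  have h1 := hardyPointSink_hasFDerivAt_regKernel (hardyPointSink_base_pos ha x₀ x)
  have h2 : HasFDerivAt (fun y : EuclideanSpace ℝ (Fin 3) => y - x₀) (ContinuousLinearMap.id ℝ (EuclideanSpace ℝ (Fin 3))) x :=
    (hasFDerivAt_id x).sub_const x₀
  have := h1.comp x h2
  simpa [Function.comp_def] using this

/-- The derivative of the regularised weight, applied to a vector. -/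
theorem hardyPointSink_fderiv_weight_apply {a : ℝ} (ha : 0 < a) (x₀ x w : EuclideanSpace ℝ (Fin 3)) :
    fderiv ℝ (fun y : EuclideanSpace ℝ (Fin 3) => Newtonian.regKernel a (y - x₀)) x w =
      -(‖x - x₀‖ ^ 2 + a) ^ (-3 / 2 : ℝ) * ⟪x - x₀, w⟫ := by
  rw [(hardyPointSink_hasFDerivAt_weight ha x₀ x).fderiv, FunLike.coe_smul,
    Pi.smul_apply, innerSL_apply_apply, smul_eq_mul]

/-- The norm of the derivative: `‖Dφ_a(x)‖ ≤ (‖x - x₀‖² + a)^{-3/2} ‖x - x₀‖`. -/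
theorem hardyPointSink_norm_fderiv_weight_le {a : ℝ} (ha : 0 < a) (x₀ x : EuclideanSpace ℝ (Fin 3)) :
    ‖fderiv ℝ (fun y : EuclideanSpace ℝ (Fin 3) => Newtonian.regKernel a (y - x₀)) x‖ ≤
      (‖x - x₀‖ ^ 2 + a) ^ (-3 / 2 : ℝ) * ‖x - x₀‖ := by
  rw [(hardyPointSink_hasFDerivAt_weight ha x₀ x).fderiv, norm_smul, norm_neg, Real.norm_eq_abs,
    abs_of_nonneg (Real.rpow_nonneg (hardyPointSink_base_pos ha x₀ x).le _), innerSL_apply_norm]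

/-- **The Laplacian of the regularised weight**: `Δφ_a(x) = -regBump a (x - x₀)` (`a > 0`). -/
theorem hardyPointSink_laplacian_weight {a : ℝ} (ha : 0 < a) (x₀ x : EuclideanSpace ℝ (Fin 3)) :
    (Δ (fun y : EuclideanSpace ℝ (Fin 3) => Newtonian.regKernel a (y - x₀))) x = -Newtonian.regBump a (x - x₀) := by
  rw [Literature.Analysis.FluidPDE.laplacian_comp_sub_right (Newtonian.regKernel a) x₀ x]
  exact Newtonian.laplacian_regKernel (hardyPointSink_base_pos ha x₀ x)

/-! ### Uniform bounds -/

/-- `(r²)^{-1/2} = r⁻¹` for `r ≥ 0`. -/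
theorem hardyPointSink_sq_rpow_neg_half {r : ℝ} (hr : 0 ≤ r) : (r ^ 2) ^ (-1 / 2 : ℝ) = r⁻¹ := by
  rw [← Real.rpow_natCast r 2, ← Real.rpow_mul hr, ← Real.rpow_neg_one r]
  norm_num

/-- `(r²)^{-3/2} = (r³)⁻¹` for `r ≥ 0`. -/
theorem hardyPointSink_sq_rpow_neg_three_halves {r : ℝ} (hr : 0 ≤ r) :
    (r ^ 2) ^ (-3 / 2 : ℝ) = (r ^ 3)⁻¹ := by
  rw [← Real.rpow_natCast r 2, ← Real.rpow_mul hr, ← Real.rpow_natCast r 3, ← Real.rpow_neg hr]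
  norm_num

/-- **`φ_a ≤ |·|⁻¹`**: `regKernel a ξ ≤ ‖ξ‖⁻¹` for `a ≥ 0` and `ξ ≠ 0`. -/
theorem hardyPointSink_regKernel_le_inv_norm {a : ℝ} (ha : 0 ≤ a) {ξ : (EuclideanSpace ℝ (Fin 3))} (hξ : ξ ≠ 0) :
    Newtonian.regKernel a ξ ≤ ‖ξ‖⁻¹ := by
  have h := Newtonian.regKernel_le_regKernel_zero (E := (EuclideanSpace ℝ (Fin 3)))
    (by rw [finrank_euclideanSpace_fin]; norm_num) ha hξ
  rw [hardyPointSink_regKernel_eq 0, add_zero, hardyPointSink_sq_rpow_neg_half (norm_nonneg _)] at h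
  exact h

/-- `φ_a ≥ 0`. -/
theorem hardyPointSink_regKernel_nonneg {a : ℝ} (ha : 0 ≤ a) (ξ : EuclideanSpace ℝ (Fin 3)) :
    0 ≤ Newtonian.regKernel a ξ :=
  Newtonian.regKernel_nonneg ha ξ

/-- **`φ_{ε²} ≤ ε⁻¹`** everywhere (`ε > 0`). -/
theorem hardyPointSink_regKernel_sq_le_inv {ε : ℝ} (hε : 0 < ε) (ξ : EuclideanSpace ℝ (Fin 3)) :
    Newtonian.regKernel (ε ^ 2) ξ ≤ ε⁻¹ := by
  rw [hardyPointSink_regKernel_eq]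
  have h1 : (‖ξ‖ ^ 2 + ε ^ 2) ^ (-1 / 2 : ℝ) ≤ (ε ^ 2) ^ (-1 / 2 : ℝ) :=
    Real.rpow_le_rpow_of_nonpos (by positivity) (by nlinarith [sq_nonneg ‖ξ‖]) (by norm_num)
  rw [hardyPointSink_sq_rpow_neg_half hε.le] at h1
  exact h1

/-- **`(‖ξ‖² + a)^{-3/2} ‖ξ‖ ≤ ‖ξ‖⁻²`** for `a ≥ 0`, `ξ ≠ 0` (so `‖Dφ_a‖ ≤ |·|⁻²`). -/
theorem hardyPointSink_rho_mul_norm_le {a : ℝ} (ha : 0 ≤ a) {ξ : (EuclideanSpace ℝ (Fin 3))} (hξ : ξ ≠ 0) :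
    (‖ξ‖ ^ 2 + a) ^ (-3 / 2 : ℝ) * ‖ξ‖ ≤ (‖ξ‖ ^ 2)⁻¹ := by
  have h := Newtonian.base_rpow_mul_norm_le (E := (EuclideanSpace ℝ (Fin 3)))
    (by rw [finrank_euclideanSpace_fin]; norm_num) ha hξ
  have e1 : (-Newtonian.expo (EuclideanSpace ℝ (Fin 3)) - 1) = (-3 / 2 : ℝ) := by
    unfold Newtonian.expo; rw [hardyPointSink_finrank_cast]; norm_num
  have e2 : (-(2 * Newtonian.expo (EuclideanSpace ℝ (Fin 3)) + 1)) = (-2 : ℝ) := by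
    unfold Newtonian.expo; rw [hardyPointSink_finrank_cast]; norm_num
  rw [e1, e2] at h
  have e3 : ‖ξ‖ ^ (-2 : ℝ) = (‖ξ‖ ^ 2)⁻¹ := by
    rw [Real.rpow_neg (norm_nonneg _), ← Real.rpow_natCast ‖ξ‖ 2]
    norm_num
  rw [e3] at h
  exact h

/-- `(‖ξ‖² + a)^{-3/2} ≤ (‖ξ‖³)⁻¹` for `a ≥ 0`, `ξ ≠ 0`. -/
theorem hardyPointSink_rho_le {a : ℝ} (ha : 0 ≤ a) {ξ : (EuclideanSpace ℝ (Fin 3))} (hξ : ξ ≠ 0) :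
    (‖ξ‖ ^ 2 + a) ^ (-3 / 2 : ℝ) ≤ (‖ξ‖ ^ 3)⁻¹ := by
  have hn : 0 < ‖ξ‖ := norm_pos_iff.2 hξ
  have h1 : (‖ξ‖ ^ 2 + a) ^ (-3 / 2 : ℝ) ≤ (‖ξ‖ ^ 2) ^ (-3 / 2 : ℝ) :=
    Real.rpow_le_rpow_of_nonpos (by positivity) (by linarith) (by norm_num)
  rwa [hardyPointSink_sq_rpow_neg_three_halves hn.le] at h1

/-- **The bump is dominated by `3a |·|⁻⁵`**: `regBump a ξ ≤ 3 a (‖ξ‖⁵)⁻¹` (`a ≥ 0`, `ξ ≠ 0`). -/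
theorem hardyPointSink_regBump_le {a : ℝ} (ha : 0 ≤ a) {ξ : (EuclideanSpace ℝ (Fin 3))} (hξ : ξ ≠ 0) :
    Newtonian.regBump a ξ ≤ 3 * a * (‖ξ‖ ^ 5)⁻¹ := by
  have hn : 0 < ‖ξ‖ := norm_pos_iff.2 hξ
  rw [hardyPointSink_regBump_eq]
  have h1 : (‖ξ‖ ^ 2 + a) ^ (-5 / 2 : ℝ) ≤ (‖ξ‖ ^ 2) ^ (-5 / 2 : ℝ) :=
    Real.rpow_le_rpow_of_nonpos (by positivity) (by linarith) (by norm_num)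
  have e : (‖ξ‖ ^ 2) ^ (-5 / 2 : ℝ) = (‖ξ‖ ^ 5)⁻¹ := by
    rw [← Real.rpow_natCast ‖ξ‖ 2, ← Real.rpow_mul hn.le, ← Real.rpow_natCast ‖ξ‖ 5,
      ← Real.rpow_neg hn.le]
    norm_num
  rw [e] at h1
  exact mul_le_mul_of_nonneg_left h1 (by positivity)

/-- `regBump a ξ ≥ 0` in `ℝ³` (`a ≥ 0`). -/
theorem hardyPointSink_regBump_nonneg {a : ℝ} (ha : 0 ≤ a) (ξ : EuclideanSpace ℝ (Fin 3)) : 0 ≤ Newtonian.regBump a ξ :=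
  Newtonian.regBump_nonneg hardyPointSink_three_le_finrank ha ξ

/-! ### Pointwise limits as `a → 0⁺` -/

/-- `regKernel a ξ → ‖ξ‖⁻¹` as `a → 0⁺`, for `ξ ≠ 0`. -/
theorem hardyPointSink_tendsto_regKernel {ξ : (EuclideanSpace ℝ (Fin 3))} (hξ : ξ ≠ 0) :
    Tendsto (fun a : ℝ => Newtonian.regKernel a ξ) (𝓝[≥] 0) (𝓝 ‖ξ‖⁻¹) := by
  have hn : 0 < ‖ξ‖ := norm_pos_iff.2 hξ
  have hb : (‖ξ‖ ^ 2 + 0 : ℝ) ≠ 0 := by positivity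
  have h1 : ContinuousAt (fun a : ℝ => (‖ξ‖ ^ 2 + a) ^ (-1 / 2 : ℝ)) 0 := by
    have : ContinuousAt (fun a : ℝ => ‖ξ‖ ^ 2 + a) 0 := by fun_prop
    exact this.rpow_const (Or.inl hb)
  have h2 := h1.tendsto
  rw [add_zero, hardyPointSink_sq_rpow_neg_half hn.le] at h2
  refine (h2.mono_left nhdsWithin_le_nhds).congr fun a => ?_
  rw [hardyPointSink_regKernel_eq]

/-- `(‖ξ‖² + a)^{-3/2} → (‖ξ‖³)⁻¹` as `a → 0⁺`, for `ξ ≠ 0`. -/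
theorem hardyPointSink_tendsto_rho {ξ : (EuclideanSpace ℝ (Fin 3))} (hξ : ξ ≠ 0) :
    Tendsto (fun a : ℝ => (‖ξ‖ ^ 2 + a) ^ (-3 / 2 : ℝ)) (𝓝[≥] 0) (𝓝 (‖ξ‖ ^ 3)⁻¹) := by
  have hn : 0 < ‖ξ‖ := norm_pos_iff.2 hξ
  have hb : (‖ξ‖ ^ 2 + 0 : ℝ) ≠ 0 := by positivity
  have h1 : ContinuousAt (fun a : ℝ => (‖ξ‖ ^ 2 + a) ^ (-3 / 2 : ℝ)) 0 := by
    have : ContinuousAt (fun a : ℝ => ‖ξ‖ ^ 2 + a) 0 := by fun_prop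
    exact this.rpow_const (Or.inl hb)
  have h2 := h1.tendsto
  rw [add_zero, hardyPointSink_sq_rpow_neg_three_halves hn.le] at h2
  exact h2.mono_left nhdsWithin_le_nhds

/-- The regularisation sequence `a_n = (n+1)⁻²` tends to `0` from the right. -/
theorem hardyPointSink_tendsto_seq :
    Tendsto (fun n : ℕ => (((n : ℝ) + 1)⁻¹) ^ 2) atTop (𝓝[≥] (0 : ℝ)) := by
  have h1 : Tendsto (fun n : ℕ => ((n : ℝ) + 1)⁻¹) atTop (𝓝 0) := by
    have := tendsto_one_div_add_atTop_nhds_zero_nat (𝕜 := ℝ)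
    simpa [one_div] using this
  have h2 : Tendsto (fun n : ℕ => (((n : ℝ) + 1)⁻¹) ^ 2) atTop (𝓝 0) := by
    simpa using h1.pow 2
  refine tendsto_nhdsWithin_iff.2 ⟨h2, Eventually.of_forall fun n => ?_⟩
  exact mem_Ici.2 (by positivity)

end Summit.NavierStokesRegularity.NavierStokesRegularity.Theorems

end
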